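import Mathlib.Algebra.BigOperators.Group.Finset.Basic
import Mathlib.Data.Fintype.Fin
import HarnessLib

/-!
# Venture HSemireg — the arithmetic of «LEMMA SSC» (single-slot cores of the unit-spread filter)

Elementary bookkeeping behind the SSC HAND CERTIFICATE of the computation cell `pub-hsemireg`
(W1 widening, value level: `widen/W1/UNITSPREAD-w1aut2.md` §1 LEMMA US / LEMMA SSC, seat
w1-aut-2; second code and censuses `widen/W1/w1cx2/ssc439/`, `ssc952/`, seat w1-cx-2).

There, a closed word through a letter `x` of a one-sided twisted complex over box-product
letters on `E^6 = S₁ × S₂ × S₃` carries, in every slot `k`, two counters: `ν k` = the number of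
leaves that are NOT units in slot `k`, and `T k` = the sum of the slot-`k` Künneth degrees of the
leaves; the target is a Künneth component `c` of `H^{0,2}`, MIXED meaning `c k ≤ 1` for all `k`
(and `∑ c = 2`). PROPOSITION UNIT-SPREAD (LEMMA US) says a word can have a non-zero value on
`c` only if, slot by slot, `ν k ≤ 1 → T k = c k` and `2 ≤ ν k → (c k ≤ T k ∧ ν k - T k ≥ 2 - c k)`
(written below without truncated subtraction as `T k + 2 ≤ ν k + c k`). A core is SINGLE-SLOT
when every leaf available on it is a non-unit in exactly one slot and has degree exactly `1`
there; then `T k = ν k` in every slot and the number of leaves is `N = ∑ ν`. LEMMA SSC: on a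
single-slot core every admissible word for a mixed target has `ν = c` slot by slot, hence
exactly `N = ∑ c = 2` leaves; and a 2-leaf word whose two leaves live in one slot feeds only a
PURE target. These are the statements indexed here, for counters valued in `ℕ` over an
arbitrary finite index type of slots (`Fin 3` in the cell):

* `nu_eq_of_singleSlot` — one slot: `c ≤ 1`, `T = ν` and the two US clauses force `ν = c`;
* `sum_nu_eq_sum` — summed over the slots: `∑ ν = ∑ c`;
* `leaves_eq_two` — the cell's instance: `N = ∑ ν` and `∑ c = 2` give `N = 2`;
* `target_vanishes_off_slot` — if every leaf is a unit outside one slot `k` (`ν j = 0` for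
  `j ≠ k`) then `c j = 0` for `j ≠ k`: the target is pure, never mixed.

HONEST FRAMING. Counter arithmetic only; the Lean index of the logical core of a HAND
CERTIFICATE used by a NECESSARY-condition, MODEL-LEVEL sieve of the cell (conditional on the
cell's PROPOSITION UNIT-SPREAD, which is NOT formalised here). No sheaf, complex, abelian
variety, A∞-structure or semiregularity map appears; nothing here says that HC, HC_CM or HC_AV
holds, and nothing here is a new case of anything.
-/

namespace Summit.Ventures.HSemireg

namespace SingleSlotCore

/-- One slot of LEMMA SSC: for a mixed target entry `c ≤ 1`, on a single-slot core (`T = ν`)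
the two clauses of LEMMA US force `ν = c`. (If `2 ≤ ν` the second clause gives
`ν + 2 ≤ ν + c`, i.e. `2 ≤ c`, impossible; so `ν ≤ 1` and the first clause gives `ν = T = c`.) -/
theorem nu_eq_of_singleSlot {ν T c : ℕ} (hc : c ≤ 1) (hss : T = ν)
    (h1 : ν ≤ 1 → T = c) (h2 : 2 ≤ ν → c ≤ T ∧ T + 2 ≤ ν + c) : ν = c := by
  by_cases hν : ν ≤ 1
  · have h := h1 hν
    omega
  · have h := (h2 (by omega)).2
    omega

/-- LEMMA SSC summed over the slots: on a single-slot core the non-unit counters of an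
admissible word for a mixed target reproduce the target, so `∑ ν = ∑ c`. -/
theorem sum_nu_eq_sum {ι : Type*} [Fintype ι] (ν T c : ι → ℕ) (hc : ∀ k, c k ≤ 1)
    (hss : ∀ k, T k = ν k) (h1 : ∀ k, ν k ≤ 1 → T k = c k)
    (h2 : ∀ k, 2 ≤ ν k → c k ≤ T k ∧ T k + 2 ≤ ν k + c k) :
    (Finset.univ.sum ν) = Finset.univ.sum c := by
  refine Finset.sum_congr rfl (fun k _ => ?_)
  exact nu_eq_of_singleSlot (hc k) (hss k) (h1 k) (h2 k)

/-- The cell's instance: every leaf of a word on a single-slot core is a non-unit in exactly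
one slot, so the number of leaves is `N = ∑ ν`; a mixed Künneth component of `H^{0,2}` has
`∑ c = 2`; hence an admissible word has exactly two leaves. -/
theorem leaves_eq_two {ι : Type*} [Fintype ι] {ν T c : ι → ℕ} {N : ℕ}
    (hN : N = Finset.univ.sum ν) (hsum : Finset.univ.sum c = 2) (hc : ∀ k, c k ≤ 1)
    (hss : ∀ k, T k = ν k) (h1 : ∀ k, ν k ≤ 1 → T k = c k)
    (h2 : ∀ k, 2 ≤ ν k → c k ≤ T k ∧ T k + 2 ≤ ν k + c k) : N = 2 := by
  rw [hN, sum_nu_eq_sum ν T c hc hss h1 h2, hsum]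

/-- The complement used by the certificate: a word all of whose leaves are units outside one
slot `k` (`ν j = 0` for `j ≠ k`) can only feed a target supported on that slot — `c j = 0` for
`j ≠ k` —, i.e. a PURE component, never a mixed one. (First US clause in slot `j` with
`ν j = 0 ≤ 1`: `c j = T j = ν j = 0`.) -/
theorem target_vanishes_off_slot {ι : Type*} {ν T c : ι → ℕ} (k : ι)
    (hν : ∀ j, j ≠ k → ν j = 0) (hss : ∀ j, T j = ν j) (h1 : ∀ j, ν j ≤ 1 → T j = c j) :
    ∀ j, j ≠ k → c j = 0 := by
  intro j hj
  have h0 : ν j = 0 := hν j hj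
  have h := h1 j (by omega)
  rw [hss j, h0] at h
  omega

end SingleSlotCore

end Summit.Ventures.HSemireg
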